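/-
Copyright (c) 2026 the pub-hodgecm-mathlib formalisation cell (harness21).  Prover seat hodgecm-mathlib-K2Liu-p02 (g7), Track B «K2-LIT» ∕ hLiu418
#184♮, socket #42F′ TOP (U5 lineage; LEAD F0P6-plan (g14) BATCH #39 (2): the COINVARIANCE adapter, instance input (F1) AT THE PARTNER EMBEDDING).
THEOREMS ONLY (no `def`, no `instance`, no notation, no named-fact hypothesis, no `sorry`).
-/
import Summits.HodgeConjecture.HodgeConjecture.Theorems.K2LiuPartnerEmbedding             -- `partnerEmb`, `isSiegelDelta_partnerEmb`, `commute_tensorEmb_partnerEmb`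
import Summits.HodgeConjecture.HodgeConjecture.Theorems.K2LiuSiegelWeilTensorPartnerLaw   -- ★ (F1) p861238 `swSectionTensor_omega_eq_mul∕_eq_smul`, `twistedStdExtension_swSectionTensor_omega_eq_smul`
import HarnessLib
-- the doubled metaplectic carriers elaborate slowly (cf. ★ `K2LiuSiegelWeilTensorGenerator`): term-mode chains, sequential elaboration
set_option Elab.async false

/-!
# Crux `HLiu418`, Road I (#42F′ by uniqueness), U5 TOP, (F1) AT `q := 1_𝔻 ⊗ k`: the Siegel–Weil section of the `M₂`-frame and #42F′'s twisted standard
# family are `(U(V′)(𝔸), χ′)`-SEMI-INVARIANT, hypothesis-free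

Cell `hodgecm-mathlib`, crux item hLiu418 = `stmt-HodgeConjecture-24832`; squad K2 ∕ K2Liu, prover K2Liu-p02 (g7); lane `--supports stmt-HodgeConjecture-24832 --as helper`,
count-neutral.  Namespace `Summit.HodgeConjecture.HodgeConjecture.Cruxes.HLiu418.K2LiuPartnerEmbeddingSWLaw`.

★ (F1) `K2LiuSiegelWeilTensorPartnerLaw` (hypothesis-first in a Siegel, `tensorEmb`-commuting `q`) AT `q := partnerEmb k` (★ `K2LiuPartnerEmbedding`:
`isSiegelDelta_partnerEmb`, `commute_tensorEmb_partnerEmb`): for a `χ`-normalised doubled Weil representation `sB` of the big datum and EVERY `k ∈ U(V′)(𝔸)`,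
`f_{ω(sB(1 ⊗ k))Φ}^{V′} = siegelDeltaCharacter χ ((1 − n′)∕2) (1 ⊗ k) • f_Φ^{V′}` (`swSectionTensor_omega_partnerEmb_eq_mul ∕ _eq_smul`), and the same scalar on the
twisted standard family `(s, h) ↦ d h · stdExtension 𝒦 s₀ f^{V′} s h` (`twistedStdExtension_swSectionTensor_omega_partnerEmb_eq_smul`) — the `hfam` of ★ (F2) p861241
`K2LiuResidueMapSemiInvariance.apply_eq_mul_of_family_eq_smul`: the residue map `T₁` of ★ U5-0c is `(U(V′)(𝔸), χ′)`-semi-invariant, input `hT` of ★ p861181 §2.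
[KudlaRallis1994, §1; Kudla1994, §2; HarrisKudlaSweet1996, §1 (1.15)–(1.17).]

HONEST LABEL.  Count-neutral helper: `HC_CM` is proved only modulo the 7 printed citations (2 remaining named inputs: hLiu418 = `stmt-HodgeConjecture-24832`,
h413 = `stmt-HodgeConjecture-24833`) until rung 0 closes; closes no socket by itself.
-/

set_option autoImplicit false
set_option linter.dupNamespace false -- the mandated namespace repeats `HodgeConjecture.HodgeConjecture`

noncomputable section

open NumberField IsDedekindDomain
open scoped Matrix Kronecker

namespace Summit.HodgeConjecture.HodgeConjecture.Cruxes.HLiu418.K2LiuPartnerEmbeddingSWLaw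

open Literature.NumberTheory.Automorphic Literature.NumberTheory.Automorphic.UnitaryGroup Literature.NumberTheory.GaloisRepresentations
open Literature.NumberTheory.GelbartRogawski1991 Literature.NumberTheory.GelbartRogawski1991.GRConstruction
open Literature.NumberTheory.Weil1964
open Literature.NumberTheory.K2Lit.SiegelDoubled
open Summit.HodgeConjecture.HodgeConjecture.Cruxes.HLiu418.K2LiuSiegelWeilTensorPartnerLaw
open Summit.HodgeConjecture.HodgeConjecture.Cruxes.HLiu418.K2LiuPartnerEmbedding

variable (L : Type) [Field L] [NumberField L] [IsCMField L]
variable {N M n : ℕ} (e : Fin N × Fin M ≃ Fin n)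
  (dV : Fin N → L) (hdV : ∀ i, IsCMField.complexConj L (dV i) = dV i) (hdV0 : ∀ i, dV i ≠ 0)
  (dW : Fin M → L) (hdW : ∀ i, IsCMField.complexConj L (dW i) = dW i) (hdW0 : ∀ i, dW i ≠ 0)
variable {M₂ M' n' : ℕ} (eW : Fin M × Fin M₂ ≃ Fin M') (e' : Fin N × Fin M' ≃ Fin n')
  (dV' : Fin M₂ → L) (hdV' : ∀ k, IsCMField.complexConj L (dV' k) = dV' k) (hdV'0 : ∀ k, dV' k ≠ 0)

/-! ## ★ (F1) at `q := 1 ⊗ k` -/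

/-- **`f_{ω(sB(1 ⊗ k))Φ}^{V′}(h) = χ′(1 ⊗ k) · f_Φ^{V′}(h)`** for EVERY `k ∈ U(V′)(𝔸)`, `χ′ = siegelDeltaCharacter χ ((1 − n′)∕2)` on the big datum (★ (F1) at the Siegel,
`tensorEmb`-commuting element `1 ⊗ k`). [cite: KudlaRallis1994, §1] [cite: Kudla1994, §2 (doubled space, Siegel parabolic)] [cite: HarrisKudlaSweet1996, §1 (1.15)–(1.17)] -/
theorem swSectionTensor_omega_partnerEmb_eq_mul {χ : HeckeCharacter L}
    {sB : HA L e' dV hdV (tensorFrame L dW eW dV') (tensorFrame_real L dW hdW eW dV' hdV') →*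
      MpD L e' dV hdV (tensorFrame L dW eW dV') (tensorFrame_real L dW hdW eW dV' hdV')}
    (hsB : IsDoubledWeilRep L e' dV hdV hdV0 (tensorFrame L dW eW dV') (tensorFrame_real L dW hdW eW dV' hdV')
      (tensorFrame_ne_zero L dW eW dV' hdW0 hdV'0) χ sB)
    (k : UnitaryGroup.adelic (Fp L) L (IsCMField.complexConj L) M₂ (Matrix.diagonal dV'))
    (Φ : piSchwartzBruhat (Fp L) (Fin (n' + n'))) (h : HA L e dV hdV dW hdW) :
    swSectionTensor L e dV hdV dW hdW eW e' dV' hdV' hdV0 hdW0 hdV'0 sB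
        (adelicMpCont.omega (Fp L) (Fin (n' + n')) (gramDA L e' dV hdV (tensorFrame L dW eW dV') (tensorFrame_real L dW hdW eW dV' hdV'))
          (sB (partnerEmb L e dV hdV dW hdW eW e' dV' hdV' k)) Φ) h =
      siegelDeltaCharacter L e' dV hdV (tensorFrame L dW eW dV') (tensorFrame_real L dW hdW eW dV' hdV') χ ((1 - (n' : ℂ)) / 2)
          (partnerEmb L e dV hdV dW hdW eW e' dV' hdV' k) *
        swSectionTensor L e dV hdV dW hdW eW e' dV' hdV' hdV0 hdW0 hdV'0 sB Φ h :=
  swSectionTensor_omega_eq_mul L e dV hdV hdV0 dW hdW hdW0 eW e' dV' hdV' hdV'0 hsB _ (isSiegelDelta_partnerEmb L e dV hdV dW hdW eW e' dV' hdV' k)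
    (fun h' => commute_tensorEmb_partnerEmb L e dV hdV dW hdW eW e' dV' hdV' h' k) Φ h

/-- **… as functions**: `f_{ω(sB(1 ⊗ k))Φ}^{V′} = χ′(1 ⊗ k) • f_Φ^{V′}`. [cite: KudlaRallis1994, §1] [cite: HarrisKudlaSweet1996, §1 (1.15)–(1.17)] -/
theorem swSectionTensor_omega_partnerEmb_eq_smul {χ : HeckeCharacter L}
    {sB : HA L e' dV hdV (tensorFrame L dW eW dV') (tensorFrame_real L dW hdW eW dV' hdV') →*
      MpD L e' dV hdV (tensorFrame L dW eW dV') (tensorFrame_real L dW hdW eW dV' hdV')}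
    (hsB : IsDoubledWeilRep L e' dV hdV hdV0 (tensorFrame L dW eW dV') (tensorFrame_real L dW hdW eW dV' hdV')
      (tensorFrame_ne_zero L dW eW dV' hdW0 hdV'0) χ sB)
    (k : UnitaryGroup.adelic (Fp L) L (IsCMField.complexConj L) M₂ (Matrix.diagonal dV'))
    (Φ : piSchwartzBruhat (Fp L) (Fin (n' + n'))) :
    swSectionTensor L e dV hdV dW hdW eW e' dV' hdV' hdV0 hdW0 hdV'0 sB
        (adelicMpCont.omega (Fp L) (Fin (n' + n')) (gramDA L e' dV hdV (tensorFrame L dW eW dV') (tensorFrame_real L dW hdW eW dV' hdV'))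
          (sB (partnerEmb L e dV hdV dW hdW eW e' dV' hdV' k)) Φ) =
      siegelDeltaCharacter L e' dV hdV (tensorFrame L dW eW dV') (tensorFrame_real L dW hdW eW dV' hdV') χ ((1 - (n' : ℂ)) / 2)
          (partnerEmb L e dV hdV dW hdW eW e' dV' hdV' k) •
        swSectionTensor L e dV hdV dW hdW eW e' dV' hdV' hdV0 hdW0 hdV'0 sB Φ :=
  swSectionTensor_omega_eq_smul L e dV hdV hdV0 dW hdW hdW0 eW e' dV' hdV' hdV'0 hsB _ (isSiegelDelta_partnerEmb L e dV hdV dW hdW eW e' dV' hdV' k)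
    (fun h' => commute_tensorEmb_partnerEmb L e dV hdV dW hdW eW e' dV' hdV' h' k) Φ

/-- **THE TWISTED STANDARD FAMILY OF #42F′ AT `ω(sB(1 ⊗ k))Φ` IS `χ′(1 ⊗ k) •` THAT OF `Φ`** (★ (F1) §3 at `q := 1 ⊗ k`; any multiplier `d`, any `𝒦`, `s₀`) — the
`hfam` of ★ (F2) `K2LiuResidueMapSemiInvariance.apply_eq_mul_of_family_eq_smul`: the residue map `T₁` of ★ U5-0c is `(U(V′)(𝔸), χ′)`-semi-invariant.
[cite: KudlaRallis1994, §1 Thm. 1.1] [cite: HarrisKudlaSweet1996, §1 (1.15)–(1.17)] -/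
theorem twistedStdExtension_swSectionTensor_omega_partnerEmb_eq_smul {χ : HeckeCharacter L}
    {sB : HA L e' dV hdV (tensorFrame L dW eW dV') (tensorFrame_real L dW hdW eW dV' hdV') →*
      MpD L e' dV hdV (tensorFrame L dW eW dV') (tensorFrame_real L dW hdW eW dV' hdV')}
    (hsB : IsDoubledWeilRep L e' dV hdV hdV0 (tensorFrame L dW eW dV') (tensorFrame_real L dW hdW eW dV' hdV')
      (tensorFrame_ne_zero L dW eW dV' hdW0 hdV'0) χ sB)
    (k : UnitaryGroup.adelic (Fp L) L (IsCMField.complexConj L) M₂ (Matrix.diagonal dV'))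
    (Φ : piSchwartzBruhat (Fp L) (Fin (n' + n'))) (d : HA L e dV hdV dW hdW → ℂ) (𝒦 : IwasawaDatum L e dV hdV dW hdW) (s₀ : ℂ) :
    (fun (s : ℂ) (h : HA L e dV hdV dW hdW) => d h *
        stdExtension 𝒦 s₀ (swSectionTensor L e dV hdV dW hdW eW e' dV' hdV' hdV0 hdW0 hdV'0 sB
          (adelicMpCont.omega (Fp L) (Fin (n' + n')) (gramDA L e' dV hdV (tensorFrame L dW eW dV') (tensorFrame_real L dW hdW eW dV' hdV'))
            (sB (partnerEmb L e dV hdV dW hdW eW e' dV' hdV' k)) Φ)) s h) =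
      siegelDeltaCharacter L e' dV hdV (tensorFrame L dW eW dV') (tensorFrame_real L dW hdW eW dV' hdV') χ ((1 - (n' : ℂ)) / 2)
          (partnerEmb L e dV hdV dW hdW eW e' dV' hdV' k) •
        fun (s : ℂ) (h : HA L e dV hdV dW hdW) => d h *
          stdExtension 𝒦 s₀ (swSectionTensor L e dV hdV dW hdW eW e' dV' hdV' hdV0 hdW0 hdV'0 sB Φ) s h :=
  twistedStdExtension_swSectionTensor_omega_eq_smul L e dV hdV hdV0 dW hdW hdW0 eW e' dV' hdV' hdV'0 hsB _
    (isSiegelDelta_partnerEmb L e dV hdV dW hdW eW e' dV' hdV' k) (fun h' => commute_tensorEmb_partnerEmb L e dV hdV dW hdW eW e' dV' hdV' h' k) Φ d 𝒦 s₀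

end Summit.HodgeConjecture.HodgeConjecture.Cruxes.HLiu418.K2LiuPartnerEmbeddingSWLaw

end
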